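import Summits.HodgeConjecture.HodgeConjecture.Theses.TropicalCuspLift

/-!
# Route TropicalCuspLift — EngineGlue (item stmt-HodgeConjecture-2527)

The support item `EngineGlue` of route `route-HodgeConjecture-TropicalCuspLift` is the route's
internal assembly

`WeilFourfoldsBase → WittTowerStep → WeilClassesAlgebraic`:

the induction base (Weil classes on abelian fourfolds are algebraic, `n = 2`) together with the
tower step (`∀ n ≥ 2, X(n) → X(n+1)`) give the thesis `X(n)` for every `n ≥ 2`.  This is pure logic
(`Nat.le_induction`); the mathematical content of the route lives in `WittTowerStep`.  The term is
the same one the route's deciding theorem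
`Summit.HodgeConjecture.HodgeConjecture.Theses.TropicalCuspLift.closes` uses inline.
-/

-- `Summit.HodgeConjecture.HodgeConjecture.Theorems` is the mandated namespace (single-problem summit:
-- Problem = Summit), which `linter.dupNamespace` flags on every declaration; the lakefile turns the
-- linter off tree-wide (weak option), restated here so stand-alone elaboration is warning-free too.
set_option linter.dupNamespace false

namespace Summit.HodgeConjecture.HodgeConjecture.Theorems

open Summit.HodgeConjecture.HodgeConjecture.Theses.TropicalCuspLift

/-- **EngineGlue of route TropicalCuspLift** (item stmt-HodgeConjecture-2527):
`WeilFourfoldsBase → WittTowerStep → WeilClassesAlgebraic`.  The base `WeilFourfoldsBase` is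
literally the thesis at half-dimension `2`, and `WittTowerStep` is literally
`∀ n ≥ 2, X(n) → X(n+1)` with `X` the thesis at half-dimension `n` inlined, so the claim is
`Nat.le_induction`. -/
theorem tropicalCuspLift_engineGlue_proof : EngineGlue := by
  unfold EngineGlue
  intro hbase hstep n hn
  induction n, hn using Nat.le_induction with
  | base => exact hbase
  | succ m hm ih => exact hstep m hm ih

end Summit.HodgeConjecture.HodgeConjecture.Theorems
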